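import Summits.Ventures.YMGap.RobustBall.PeriodisedDLR
import Summits.Ventures.YMGap.RobustBall.StarFarEnergyZd
import Summits.Ventures.YMGap.RobustBall.MassGapOnBallZdW
import HarnessLib

/-!
# Venture YMGap, track ROBUST-BALL (Y2) — «C-ONE-W», step 1: THE PERIODISED FAMILY OF A SUMMABLE (INFINITE-RANGE)
# MEMBER and THE KERNEL APPROXIMATION BY TRUNCATIONS

HONEST FRAMING. WHAT THIS IS: a venture file (cell `pub-ymgap`, track Y2 ROBUST-BALL, seat ds-2). ds-3's
`PeriodisedDLR.lean` periodises a FINITE-RANGE member `(W, supp)` of the gauge-invariant `ℤ^d` ball; here the member is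
a SUMMABLE link potential `W` of ARBITRARY range (rb-p1's tier-2 specification `perturbedYMS`, e.g. every member of
`MemBallZdW κ ε₀ ε₁`).
* `periodisedFamilyS W …` (definition) — on the torus of side `L + 1`, the chart member of the box family (radius
  `L / 2`) of the TRUNCATION `truncZd (L / 4) 0 W` (the terms of the link sets based within sup-distance `L / 4` of the
  origin; a finite-range member, so ds-3's fixed-torus machinery applies torus by torus); the standing facts of the
  truncations (`dependsOn_truncZd`, `isZdGaugeInvariant_truncZd`, `continuous_truncZd`, …) and their box geometry
  (`activeFamily_truncZd_subset_boxFamily`, `perturbedNbr_truncSuppZd_base_subset`).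
* `abs_integral_perturbedYMS_sub_truncZd_le` — THE KERNEL APPROXIMATION: for bounded measurable `F` (`|F| ≤ C`), every
  finite `Λ`, every boundary condition `η` and every radius `D`,
  `|∫ F dγ^W_Λ(·|η) − ∫ F dγ^{trunc_D W}_Λ(·|η)| ≤ C · τ_D(Λ)`, `τ_D(Λ) = Σ'_{X ⊄ box_D} Σ_{e ∈ Λ} 𝟙[e ∈ X] B_X` — the kernel of
  `W` is the tier-1 kernel of the truncation tilted by minus the far energy (this seat's `perturbedYMS_eq_tilted_truncZd`,
  `StarFarEnergyZd.lean`), whose sup is `≤ τ_D(Λ)` (`abs_farEnergyZd_le_farMajorant`); Simon's sup-norm tilt lemma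
  (`abs_integral_tilted_sub_integral_tilted_le_linear'`); and `tendsto_farMajorant`: `τ_D(Λ) → 0` as `D → ∞`.
The DLR theorem for the limit states is `PeriodisedDLRSummable.lean`. WHAT THIS IS NOT: no rate; strong-coupling lattice
bookkeeping; nothing about the continuum or the Clay problem.
References: H.-O. Georgii (2011) (2.15), Thm. 4.17; B. Simon (1979) Lemma p. 184; the tree `PeriodisedDLR.lean`,
`PeriodisedBox.lean` (ds-3), `PerturbedLimitStates.lean` (rb-p2), `StarFarEnergyZd.lean`, `MassGapOnBallZdW.lean`,
`StarChartMember.lean` (this seat), `SummableSpecification.lean` (rb-p1).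
-/

noncomputable section

open MeasureTheory Filter Topology Function Finset
open Literature.Probability.LatticeModels
open Literature.Probability.LatticeModels.DobrushinMetric (abs_integral_tilted_sub_integral_tilted_le_linear')
open Literature.MathematicalPhysics.QuantumLattice hiding torusNorm
open Literature.MathematicalPhysics.QuantumFieldTheory hiding ZdEdge Site
open Literature.MathematicalPhysics.QuantumFieldTheory.Balaban1983to89.StrongCouplingTorusWindow (specAvg)
open Summit.Ventures.YMGap.DSWindowZd

namespace Summit.Ventures.YMGap.RobustBall

variable {d N : ℕ}

/-! ### The truncations of a potential: the four standing facts -/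

section Trunc

variable {W : Potential (ZdEdge d) (SUN N)}

/-- The truncation reads only its own links. [folklore] -/
theorem dependsOn_truncZd (hdep : ∀ X, DependsOn (W X) (↑X : Set (ZdEdge d))) (D : ℕ) (s : Site d) :
    ∀ X, DependsOn (truncZd D s W X) (↑X : Set (ZdEdge d)) := fun X => by
  by_cases hX : X ⊆ starNbhdZdR D s
  · rw [truncZd_of_subset hX]; exact hdep X
  · rw [truncZd_of_not_subset hX]; exact fun _ _ _ => rfl

/-- The truncation is gauge invariant. [folklore] -/
theorem isZdGaugeInvariant_truncZd (hg : ∀ X, IsZdGaugeInvariant (W X)) (D : ℕ) (s : Site d) :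
    ∀ X, IsZdGaugeInvariant (truncZd D s W X) := fun X => by
  by_cases hX : X ⊆ starNbhdZdR D s
  · rw [truncZd_of_subset hX]; exact hg X
  · rw [truncZd_of_not_subset hX]; exact fun _ _ => rfl

/-- The truncation has continuous terms. [folklore] -/
theorem continuous_truncZd (hWc : ∀ X, Continuous (W X)) (D : ℕ) (s : Site d) :
    ∀ X, Continuous (truncZd D s W X) := fun X => by
  by_cases hX : X ⊆ starNbhdZdR D s
  · rw [truncZd_of_subset hX]; exact hWc X
  · rw [truncZd_of_not_subset hX]; exact continuous_const

/-- The truncation has measurable terms. [folklore] -/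
theorem measurable_truncZd (hWc : ∀ X, Continuous (W X)) (D : ℕ) (s : Site d) :
    ∀ X, Measurable (truncZd D s W X) := fun X => (continuous_truncZd hWc D s X).measurable

/-- The truncation has bounded terms. [folklore] -/
theorem exists_bound_truncZd (hWc : ∀ X, Continuous (W X)) (D : ℕ) (s : Site d) :
    ∀ X, ∃ C, ∀ U, |truncZd D s W X U| ≤ C := fun X => exists_bound_of_continuous (continuous_truncZd hWc D s X)

end Trunc

/-! ### The periodised family of a summable member -/

/-- **THE PERIODISED FAMILY of the summable member `W`**: on the torus of side `L + 1`, the chart member of the box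
family (radius `L / 2`) of the truncation `truncZd (L / 4) 0 W` — the terms of the link sets based within sup-distance
`L / 4` of the origin, read through the periodic lift. A `PerturbationFamily d N` (rb-p2). [folklore] -/
def periodisedFamilyS (W : Potential (ZdEdge d) (SUN N)) (hdep : ∀ X, DependsOn (W X) (↑X : Set (ZdEdge d)))
    (hg : ∀ X, IsZdGaugeInvariant (W X)) (hWc : ∀ X, Continuous (W X)) : PerturbationFamily d N :=
  fun L => chartMember (L + 1) (boxFamily (truncZd (L / 4) 0 W) (truncSuppZd (L / 4) 0) (L / 2)) (truncZd (L / 4) 0 W)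
    (dependsOn_truncZd hdep _ _) (isZdGaugeInvariant_truncZd hg _ _) (measurable_truncZd hWc _ _)
    (exists_bound_truncZd hWc _ _)

/-! ### Geometry of the truncation: boxes -/

/-- A link of the radius-`D` box around the origin is based in the centred box of every radius `n ≥ D`. [folklore] -/
theorem mem_siteBox_of_mem_starNbhdZdR_zero {D n : ℕ} (hDn : D ≤ n) {y : ZdEdge d} (hy : y ∈ starNbhdZdR D 0) :
    y.1 ∈ siteBox d n := by
  rw [mem_siteBox]
  intro i
  have h := (mem_starNbhdZdR.1 hy) i
  rw [Pi.zero_apply, sub_zero] at h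
  rw [Int.abs_eq_natAbs]
  exact_mod_cast h.trans hDn

/-- **The active family of the truncation is inside its box family** at every radius `n ≥ D` (every active set is
inside the radius-`D` box). [folklore] -/
theorem activeFamily_truncZd_subset_boxFamily {W : Potential (ZdEdge d) (SUN N)} {D n : ℕ} (hDn : D ≤ n)
    (Λ : Finset (ZdEdge d)) :
    activeFamily (truncZd D 0 W) (truncSuppZd D 0) Λ ⊆ boxFamily (truncZd D 0 W) (truncSuppZd D 0) n := by
  intro X hX
  obtain ⟨hXs, hne, hX0⟩ := mem_activeFamily.1 hX
  obtain ⟨hXbox, -⟩ := mem_truncSuppZd.1 hXs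
  obtain ⟨e, he⟩ := hne
  have heX : e ∈ X := (Finset.mem_inter.1 he).1
  refine mem_boxFamily.2 ⟨mem_truncSuppZd.2 ⟨hXbox, ⟨e, Finset.mem_inter.2 ⟨heX, ?_⟩⟩⟩,
    fun e' he' => mem_siteBox_of_mem_starNbhdZdR_zero hDn (hXbox he'), hX0⟩
  exact mem_boxLinks.2 (mem_siteBox_of_mem_starNbhdZdR_zero hDn (hXbox heX))

/-- **The `W`-collar of `Λ` for the truncation is inside the box**: the links of the sets of `truncSuppZd D 0` through
a link are based in `siteBox n` for `n ≥ D`. [folklore] -/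
theorem perturbedNbr_truncSuppZd_base_subset {D n : ℕ} (hDn : D ≤ n) {Λ : Finset (ZdEdge d)}
    (hΛ : (Λ.biUnion linkPlaqNbr).image Prod.fst ⊆ siteBox d n) :
    (Λ.biUnion (perturbedNbr (truncSuppZd D 0))).image Prod.fst ⊆ siteBox d n := by
  intro v hv
  obtain ⟨y, hy, rfl⟩ := Finset.mem_image.1 hv
  obtain ⟨e, he, hye⟩ := Finset.mem_biUnion.1 hy
  rw [perturbedNbr] at hye
  have hy' := Finset.mem_of_mem_erase hye
  rcases Finset.mem_union.1 hy' with h1 | h2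
  · exact hΛ (Finset.mem_image_of_mem _ (Finset.mem_biUnion.2 ⟨e, he, h1⟩))
  · obtain ⟨X, hX, hyX⟩ := Finset.mem_biUnion.1 h2
    have hXs := (Finset.mem_filter.1 hX).1
    exact mem_siteBox_of_mem_starNbhdZdR_zero hDn ((mem_truncSuppZd.1 hXs).1 hyX)

/-! ### The kernel approximation by truncations -/

section Kernel

variable {W : Potential (ZdEdge d) (SUN N)} {Bm : Finset (ZdEdge d) → ℝ}

/-- **The far majorant** `τ_D(Λ) = Σ'_{X ⊄ box_D} Σ_{e ∈ Λ} 𝟙[e ∈ X] B_X`: summable termwise data. [folklore] -/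
theorem summable_farMajorant (h : IsLinkSummable W Bm) (D : ℕ) (Λ : Finset (ZdEdge d)) :
    Summable fun X : Finset (ZdEdge d) =>
      (if ¬ X ⊆ starNbhdZdR D 0 then ∑ e ∈ Λ, (if e ∈ X then Bm X else 0) else 0) := by
  haveI : Nonempty (LGConfig d (SUN N)) := ⟨fun _ => 1⟩
  have h0 : ∀ X, 0 ≤ ∑ e ∈ Λ, (if e ∈ X then Bm X else 0) := fun X =>
    Finset.sum_nonneg fun e _ => by split_ifs; exacts [h.nonneg X (fun _ => 1), le_rfl]
  -- `split_ifs` splits on `X ⊆ box` (the negated condition): first the `else` branch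
  exact Summable.of_nonneg_of_le (fun X => by split_ifs; exacts [le_rfl, h0 X])
    (fun X => by split_ifs; exacts [h0 X, le_rfl]) (h.summable_volume Λ)

/-- **The far energy is bounded by the far majorant**, uniformly in the configuration. [folklore] -/
theorem abs_farEnergyZd_le_farMajorant (h : IsLinkSummable W Bm) (D : ℕ) (Λ : Finset (ZdEdge d))
    (U : LGConfig d (SUN N)) :
    |farEnergyZd D 0 Λ W U| ≤
      ∑' X : Finset (ZdEdge d), (if ¬ X ⊆ starNbhdZdR D 0 then ∑ e ∈ Λ, (if e ∈ X then Bm X else 0) else 0) := by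
  haveI : Nonempty (LGConfig d (SUN N)) := ⟨fun _ => 1⟩
  have hterm : ∀ X : Finset (ZdEdge d),
      |(if (X ∩ Λ).Nonempty ∧ ¬ X ⊆ starNbhdZdR D 0 then W X U else 0)| ≤
        (if ¬ X ⊆ starNbhdZdR D 0 then ∑ e ∈ Λ, (if e ∈ X then Bm X else 0) else 0) := by
    intro X
    by_cases hfar : X ⊆ starNbhdZdR D 0
    · rw [if_neg (fun hh => hh.2 hfar), if_neg (fun hh => hh hfar), abs_zero]
    · rw [if_pos hfar]
      have h1 := h.abs_term_le Λ X U
      by_cases hne : (X ∩ Λ).Nonempty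
      · rw [if_pos ⟨hne, hfar⟩]; rw [if_pos hne] at h1; exact h1
      · rw [if_neg (fun hh => hne hh.1), abs_zero]; rw [if_neg hne, abs_zero] at h1; exact h1
  have hn : Summable fun X : Finset (ZdEdge d) =>
      ‖(if (X ∩ Λ).Nonempty ∧ ¬ X ⊆ starNbhdZdR D 0 then W X U else 0)‖ :=
    Summable.of_nonneg_of_le (fun X => norm_nonneg _) (fun X => by rw [Real.norm_eq_abs]; exact hterm X)
      (summable_farMajorant h D Λ)
  unfold farEnergyZd
  calc |∑' X : Finset (ZdEdge d), (if (X ∩ Λ).Nonempty ∧ ¬ X ⊆ starNbhdZdR D 0 then W X U else 0)|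
      = ‖∑' X : Finset (ZdEdge d), (if (X ∩ Λ).Nonempty ∧ ¬ X ⊆ starNbhdZdR D 0 then W X U else 0)‖ :=
        (Real.norm_eq_abs _).symm
    _ ≤ ∑' X, ‖(if (X ∩ Λ).Nonempty ∧ ¬ X ⊆ starNbhdZdR D 0 then W X U else 0)‖ := norm_tsum_le_tsum_norm hn
    _ ≤ _ := hn.tsum_le_tsum (fun X => by rw [Real.norm_eq_abs]; exact hterm X) (summable_farMajorant h D Λ)

/-- **THE FAR MAJORANT TENDS TO ZERO** as the box radius grows: every finite family of link sets is eventually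
inside the box, and the remainder is the tail of a convergent series. [folklore] -/
theorem tendsto_farMajorant (h : IsLinkSummable W Bm) (Λ : Finset (ZdEdge d)) :
    Tendsto (fun D : ℕ => ∑' X : Finset (ZdEdge d),
      (if ¬ X ⊆ starNbhdZdR D 0 then ∑ e ∈ Λ, (if e ∈ X then Bm X else 0) else 0)) atTop (𝓝 0) := by
  classical
  haveI : Nonempty (LGConfig d (SUN N)) := ⟨fun _ => 1⟩
  set g : Finset (ZdEdge d) → ℝ := fun X => ∑ e ∈ Λ, (if e ∈ X then Bm X else 0) with hg
  have hg0 : ∀ X, 0 ≤ g X := fun X =>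
    Finset.sum_nonneg fun e _ => by split_ifs; exacts [h.nonneg X (fun _ => 1), le_rfl]
  have hgs : Summable g := h.summable_volume Λ
  -- every finite link set is eventually inside the box
  have hin : ∀ X : Finset (ZdEdge d), ∀ᶠ D : ℕ in atTop, X ⊆ starNbhdZdR D 0 := by
    intro X
    refine Filter.eventually_atTop.2 ⟨X.sup fun e => supNormZd e.1, fun D hD e he => ?_⟩
    refine mem_starNbhdZdR.2 fun i => ?_
    rw [Pi.zero_apply, sub_zero]
    exact (natAbs_le_supNormZd e.1 i).trans ((Finset.le_sup (f := fun e : ZdEdge d => supNormZd e.1) he).trans hD)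
  rw [Metric.tendsto_atTop]
  intro ε hε
  -- a finite family carrying all but `ε / 2` of the series
  have hT0 : Tendsto (fun T : Finset (Finset (ZdEdge d)) => ∑ X ∈ T, g X) atTop (𝓝 (∑' X, g X)) := hgs.hasSum
  obtain ⟨T, hT⟩ := Metric.tendsto_atTop.1 hT0 (ε / 2) (by positivity)
  have hTε : ∑' X, g X - ∑ X ∈ T, g X < ε / 2 := by
    have := hT T le_rfl
    rw [Real.dist_eq] at this
    exact (abs_lt.1 this).1 |> fun hh => by linarith
  -- the radius beyond which every set of `T` is inside the box
  obtain ⟨D₀, hD₀⟩ := Filter.eventually_atTop.1 ((T.eventually_all).2 fun X _ => hin X)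
  refine ⟨D₀, fun D hD => ?_⟩
  have hle : ∀ X, (if ¬ X ⊆ starNbhdZdR D 0 then g X else 0) ≤ (if X ∈ T then 0 else g X) := by
    intro X
    by_cases hXT : X ∈ T
    · rw [if_pos hXT, if_neg (not_not.2 (hD₀ D hD X hXT))]
    · rw [if_neg hXT]; split_ifs; exacts [hg0 X, le_rfl]
  have htails : Summable fun X => if X ∈ T then (0 : ℝ) else g X :=
    Summable.of_nonneg_of_le (fun X => by split_ifs; exacts [le_rfl, hg0 X])
      (fun X => by split_ifs; exacts [hg0 X, le_rfl]) hgs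
  have hsplit : ∑ X ∈ T, g X + ∑' X, (if X ∈ T then (0 : ℝ) else g X) = ∑' X, g X := by
    have h1 : Summable fun X => if X ∈ T then g X else (0 : ℝ) :=
      summable_of_ne_finset_zero (s := T) fun X hX => if_neg hX
    have h3 : ∑' X, (if X ∈ T then g X else (0 : ℝ)) = ∑ X ∈ T, g X := by
      rw [tsum_eq_sum (s := T) (fun X hX => if_neg hX)]
      exact Finset.sum_congr rfl fun X hX => if_pos hX
    rw [← h3, ← h1.tsum_add htails]
    exact tsum_congr fun X => by split_ifs <;> ring
  have hnn : 0 ≤ ∑' X, (if ¬ X ⊆ starNbhdZdR D 0 then g X else 0) :=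
    tsum_nonneg fun X => by split_ifs; exacts [le_rfl, hg0 X]
  rw [Real.dist_eq, sub_zero, abs_of_nonneg hnn]
  calc ∑' X, (if ¬ X ⊆ starNbhdZdR D 0 then g X else 0) ≤ ∑' X, (if X ∈ T then (0 : ℝ) else g X) :=
        (summable_farMajorant h D Λ).tsum_le_tsum hle htails
    _ = ∑' X, g X - ∑ X ∈ T, g X := by linarith [hsplit]
    _ < ε := by linarith

/-- **THE KERNEL APPROXIMATION**: for `SU(N)`, a summable member with continuous terms, a finite volume `Λ`, every
boundary condition `η` and every bounded measurable `F` (`|F| ≤ C`):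
`|∫ F dγ^W_Λ(·|η) − ∫ F dγ^{trunc_D W}_Λ(·|η)| ≤ C · τ_D(Λ)` — the kernel of `W` is the tier-1 kernel of the truncation
tilted by minus the far energy (`perturbedYMS_eq_tilted_truncZd`), whose sup is `≤ τ_D(Λ)`; Simon's sup-norm tilt
lemma. [folklore] -/
theorem abs_integral_perturbedYMS_sub_truncZd_le (h : IsLinkSummable W Bm) (hWc : ∀ X, Continuous (W X)) (β : ℝ)
    (D : ℕ) (Λ : Finset (ZdEdge d)) (η : LGConfig d (SUN N)) {F : LGConfig d (SUN N) → ℝ} (hFm : Measurable F)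
    {C : ℝ} (hC : ∀ U, |F U| ≤ C) :
    |∫ U, F U ∂(perturbedYMS (d := d) (fundamentalRep (Fin N)) β W Λ η) -
        ∫ U, F U ∂(perturbedYM (d := d) (fundamentalRep (Fin N)) β (truncZd D 0 W) (truncSuppZd D 0) Λ η)| ≤
      C * ∑' X : Finset (ZdEdge d), (if ¬ X ⊆ starNbhdZdR D 0 then ∑ e ∈ Λ, (if e ∈ X then Bm X else 0) else 0) := by
  haveI : SecondCountableTopology (Matrix (Fin N) (Fin N) ℂ) :=
    inferInstanceAs (SecondCountableTopology (Fin N → Fin N → ℂ))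
  haveI : SecondCountableTopology (SUN N) := Topology.IsEmbedding.subtypeVal.secondCountableTopology
  have hρ : Continuous (fundamentalRep (Fin N)) := continuous_fundamentalRep (Fin N)
  set ν := perturbedYM (d := d) (fundamentalRep (Fin N)) β (truncZd D 0 W) (truncSuppZd D 0) Λ η with hν
  haveI : IsProbabilityMeasure ν :=
    isProbabilityMeasure_perturbedYM _ hρ β (measurable_truncZd hWc D 0) (exists_bound_truncZd hWc D 0) _ Λ η
  set τ : ℝ := ∑' X : Finset (ZdEdge d),
    (if ¬ X ⊆ starNbhdZdR D 0 then ∑ e ∈ Λ, (if e ∈ X then Bm X else 0) else 0) with hτ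
  have hfar : ∀ U, |farEnergyZd D 0 Λ W U| ≤ τ := abs_farEnergyZd_le_farMajorant h D Λ
  have hfm : Measurable fun U => -farEnergyZd D 0 Λ W U := (continuous_farEnergyZd h hWc D 0 Λ).measurable.neg
  have hosc : ∀ a b, |F a - F b| ≤ 2 * C := fun a b => (abs_sub _ _).trans (by linarith [hC a, hC b])
  rw [perturbedYMS_eq_tilted_truncZd (fundamentalRep (Fin N)) hρ h hWc β D 0 Λ η, ← hν]
  have key := abs_integral_tilted_sub_integral_tilted_le_linear' ν (h₂ := 0) hfm measurable_zero
    ⟨τ, fun U => by rw [abs_neg]; exact hfar U⟩ ⟨0, fun U => by simp⟩ (ε := τ)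
    (fun U => by rw [Pi.zero_apply, sub_zero, abs_neg]; exact hfar U) hFm ⟨C, hC⟩ hosc
  rw [tilted_zero] at key
  calc _ ≤ τ / 2 * (2 * C) := key
    _ = C * τ := by ring

end Kernel

end Summit.Ventures.YMGap.RobustBall

end
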